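import Literature.MathematicalPhysics.QuantumFieldTheory.Balaban1983to89.Node00.RateRecordW1Maps

/-!
# NODE 00 — W1 (the history-Lipschitz OBJECT), FILE `RateRecordW1MapsAdm`: the level pairing and the reading data of record WITH THE BACKGROUND SLOTS
# RESTRICTED TO ADMISSIBLE BACKGROUNDS (the readings lie in a given space-table family BY TYPE)

Cell `pub-ymgap`, HUMAN RULING D-0062 (Track A).  Typed by the prover seat `pub-ymgap-dag-n22-c` (g3) on its LOCATED-BGA (pub-ymgap INBOX, 2026-08-27) as repair (R1),
reviewed, endorsed (repair census (R1) ✓ ∕ (R2)–(R4) ✗ concurring) and filed verbatim by the definer seat `pub-ymgap-node00-def-W1` (g4, the object's lineage; handover on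
the cell bus), crediting the definer seat `pub-ymgap-node00-def-W1` (g2 `RateRecordW1Reading` p465810: `LevelPairing`, `ReadingData`; g3 `RateRecordW1Maps` p473218: `pairOfRecord`,
`LevelPairing.ofRecord`, `ReadingData.ofRecord`), whose docstring states the intention this file TYPES: «the run-A ∕ run-B background types (understood as already
restricted to the domains of definition)».  Hypothesis-schema; total definitions + `rfl` faces; nothing of [I]–[II] asserted; one module (D-0064).

WHY.  `LevelPairing.ofRecord` pins run A ∕ run B to ALL `SU(N)` gauge fields of `F.P k` ∕ `F.P (k+1)`.  The rate statements keyed to the reading (`T4OutputRate.NE5`,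
`NE9`, hence `N18At`, `N22At`) quantify over EVERY background of the slot, and every STRIP ∕ (1.18)-based producer needs the readings `(ιU, 0)` to lie in the spaces
`U^c_j(Y, α₀, α₁)` of record — false for a gauge field with a plaquette far from `1` inside `Y` (`B12RegularSpaces111.CondI.plaq_lt : ‖∂U − 1‖ < α₀ξ²`; the defect
`‖u(∂U−1)u⁻¹‖ ≥ 2` persists on the whole `Gᶜ`-orbit).  Bałaban's terms `E^{(j)}(X; g⃗; 𝐔, 𝐉)` are defined and bounded on `U^c_j(X, α₀, α₁)` only ([I] p. 263: «defined and
analytic on the space U^c_j(X, α₀, α₁)», (1.18) «for all configurations (𝐔, 𝐉) ∈ U^c_j»); the backgrounds at which Theorem 1 reads them are the RG backgrounds, which ARE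
admissible ([I] (0.21)–(0.22), Lemma 1).  So the slot types should be the ADMISSIBLE backgrounds.  This file types, for a space-table family
`sp k j Y ⊆ Φ(F.P k)` given as DATA (the spaces of record of the run of length `k`, e.g. `W1.spaceOfRecord …`):
* §1 `AdmBg F M N sp k` — the subtype of `SU(N)` gauge fields `U` on `F.P k` whose reading `(ιU, 0)` lies in `sp k j Y` for every creation step `j` and domain `Y`
  (`AdmBg.mem`; `AdmBg.nonempty_of_mem` — inhabited as soon as one field reads inside every space, e.g. `U ≡ 1` at the spaces of record in the window);
* §2 `LevelPairing.ofRecordAdm` — W1 g3's pairing of record with `BgA := AdmBg … k`, `BgB := AdmBg … (k+1)`, readings through `Subtype.val`, `pair := pairOfRecord`, the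
  gauge restricted, and the transport `T₀` restricted along a DISPLAYED admissibility-preservation clause `hT₀` (the one-step averaging maps admissible run-B backgrounds
  to admissible run-A backgrounds — [I] Lemma 1 ∕ (0.21)–(0.22) content, NOT proved here); `rfl` faces; ★ `LevelPairing.ofRecordAdm_embA_mem` — THE READINGS LIE IN THE
  SPACES BY TYPE;
* §3 `ReadingData.ofRecordAdm` + faces; `ne5_ofRecordAdm_iff`, `ne9_ofRecordAdm_iff` (`Iff.rfl`): NE5 ∕ NE9 at the admissible reading quantify over admissible backgrounds.
CONSUMERS: dag-n22-c's module 9 (`…N22W1StripN18Edge`, generic) and module 12 (`…N22W1StripAnyReading`) apply with `hsp := LevelPairing.ofRecordAdm_embA_mem` and the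
coherence clauses by `rfl` ∕ `dj_pairOfRecord` ∕ `range_pairOfRecord` ∕ `⟨U, rfl⟩` (both slots of consecutive pairings are the SAME subtype `AdmBg … (k+1)`).

v1.1 (APPEND-ONLY, same seat g4, after the cell's LENS-transfer seat `ym-lens-BalabanUVNodes-transfer` (g4) v4 §10.2 ∕ §2b «GENERATED CARRIERS», markdown + farm-checked
sketch sha16 7dbe0f7c60e36e1b ∕ a9843be344f22ed2, folded by the DEDUP desk to the object owner): §4 THE GENERATED TABLES.  The displayed clause `hT₀` of §2–§3 is a
PARAMETER by design; at ONE `spaceOfRecord`-keyed family with the SAME thresholds on both runs it is NOT what [I] prints — p. 263 L9–13 gives the regularity of the `n`-fold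
averages of a strictly small field with ONE factor `2` (`2B₃`) UNIFORMLY in `n` (ORIGIN form, «from Proposition 9 [15]»), and p. 262 condition (iv) ∕ (1.15)–(1.16) builds the
regularity of ALL the averages `M^n(U)` INTO the definition of `U^c_j(X, α₀, α₁)`; the sibling move is King's nesting of small-field restrictions BY CONSTRUCTION ([King1986]
(3.40)–(3.42) p. 660).  §4 types the instance on which `hT₀` costs nothing: the level-indexed INDUCTIVE family `AvGen Pplus T₀` (the least averaging-closed family of
backgrounds containing the strictly small ones `Pplus`), the cast-free top-first iterate `avIter` with ★ `avGen_iff_origin` (generated ⟺ an `a`-fold average of a strictly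
small field `a` levels up — the one index identity `k + 1 + a = k + a + 1` handled once, `castLevel` ∕ `T_avIter_succ`), the table family `spGen F M N Pplus T₀` (image in `Φ`,
constant in `(j, Y)`; `mem_spGen_iff` by ★ `ofBackgroundC_ιSU_injective`), ★ `hT₀_spGen` — `hT₀` ON THE GENERATED TABLES IS A THEOREM (transport is a constructor; the one
inhabited domain index is `domZero`), `AdmBg.avGen` ∕ `AdmBg.ofAvGen` ∕ `AdmBg.nonempty_spGen_of_strict` (the slot carriers at `spGen` ARE the generated backgrounds; inhabited by
any strictly small field, e.g. the minimisers), the reading `ReadingData.ofRecordGen := ReadingData.ofRecordAdm … (spGen …) … (hT₀_spGen …)` (+ faces), and the two forms of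
the ONE displayed Bałaban clause left — generated form `hunif : AvGen k U → (ιU,0) ∈ sp k j Y` (`spGen_subset_of_hunif`) and the print's ORIGIN form
`horig : Pplus (k+a) U₀ → (ι(avIter k a U₀), 0) ∈ sp k j Y` (`spGen_subset_of_origin`) — both giving the entrywise inclusion `spGen ⊆ sp` that the antitone transfer of rate
statements consumes (dag-n18-d's `s_N18_readingAdm₁₂_antitone`).  `hunif` ∕ `horig` are DISPLAYED, NOT proved ([I] p. 263 L5–21 + [15] Prop. 9 content).

HONEST SCOPE.  Definitions and `rfl` faces only; the space-table family, the towers, the gauge, `T₀` and its preservation clause are PARAMETERS; nothing of Bałaban's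
asserted; NE5 ∕ NE9 NOT IN PRINT; no node discharged; counts unmoved; one finite four-torus programme at fixed ε — NOT infinite volume, NOT OS on ℝ⁴, NOT a mass gap,
NOT Clay.  No instance, no notation, no attribute change.

References (TYPES only): [I] = [Balaban1987RG1] (0.8)–(0.10) p. 253, (0.21)–(0.22) p. 256, (0.24)–(0.25) p. 257, (1.11)–(1.16) p. 262, (1.18) p. 263, p. 263 L5–21
(averages of regular fields, Prop. 9 of [15]); [II] = [Balaban1988RG2Cluster] (2.13) p. 14; [King1986] (3.40)–(3.42) p. 660 (the sibling's nesting by construction, docstrings only).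
-/

noncomputable section

namespace Literature.MathematicalPhysics.QuantumFieldTheory.Balaban1983to89.Node00

open Literature.MathematicalPhysics.QuantumFieldTheory.Balaban1983to89
open TreeLengthTorus T4Continuum Sect2
open Literature.MathematicalPhysics.QuantumFieldTheory.Balaban1983to89.T4OutputRate (Carriers Functional Window NE5 NE9)

namespace W1

variable (F : T4Family) (M N : ℕ)

/-! ## §1  Admissible backgrounds for a space-table family -/

/-- **THE ADMISSIBLE BACKGROUNDS OF THE `k`-TH TORUS** for a space-table family `sp` (`sp k j Y ⊆ Φ(F.P k)` = the space `U^c_j(Y, α₀, α₁)` of record of the run of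
length `k`): the `SU(N)`-valued gauge fields `U` on the fine lattice of `F.P k` whose reading `(ιU, 0)` lies in `sp k j Y` for EVERY creation step `j` and domain
`Y ∈ 𝐃_j` — [I]'s «configurations (𝐔, 𝐉) ∈ U^c_j(X, α₀, α₁)» at `𝐉 = 0`, the class of backgrounds on which the terms are defined and (1.18) holds.
[cite: Balaban1987RG1, (1.11)-(1.16) p.262 and (1.18) p.263] -/
def AdmBg (sp : (k j : ℕ) → (domSys (F.P k) M j).Dom → Set (CPair (F.P k) (MatA N))) (k : ℕ) : Type :=
  {U : GaugeField (F.P k) 0 (SU N) // ∀ (j : ℕ) (Y : (domSys (F.P k) M j).Dom), ofBackgroundC (ιSU N) U ∈ sp k j Y}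

/-- An admissible background's reading lies in every space of the table. [cite: Balaban1987RG1, (1.18) p.263 (bookkeeping)] -/
theorem AdmBg.mem {sp : (k j : ℕ) → (domSys (F.P k) M j).Dom → Set (CPair (F.P k) (MatA N))} {k : ℕ} (U : AdmBg F M N sp k)
    (j : ℕ) (Y : (domSys (F.P k) M j).Dom) : ofBackgroundC (ιSU N) U.1 ∈ sp k j Y :=
  U.2 j Y

/-- An admissible background EXISTS as soon as one field's reading lies in every space of the table (at the spaces of record in the window the unit
configuration does: `Node00.one_mem_spaceI_stage12`); without it the rate statements at the admissible reading are vacuously true (A1-visible).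
[cite: Balaban1987RG1, (1.11)-(1.16) p.262 (bookkeeping)] -/
theorem AdmBg.nonempty_of_mem {sp : (k j : ℕ) → (domSys (F.P k) M j).Dom → Set (CPair (F.P k) (MatA N))} {k : ℕ}
    (U₀ : GaugeField (F.P k) 0 (SU N)) (h : ∀ (j : ℕ) (Y : (domSys (F.P k) M j).Dom), ofBackgroundC (ιSU N) U₀ ∈ sp k j Y) :
    Nonempty (AdmBg F M N sp k) :=
  ⟨⟨U₀, h⟩⟩

/-! ## §2  The level pairing of record with admissible background slots -/

variable (k : ℕ)

/-- **THE LEVEL-`k` PAIRING OF RECORD WITH ADMISSIBLE SLOTS**: W1 g3's `LevelPairing.ofRecord` with run A = the admissible backgrounds of `F.P k`, run B = those of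
`F.P (k+1)` (for the SAME table family `sp`, so that run B of pairing `k` IS run A of pairing `k+1`), readings `(ιU, 0)` of the underlying fields, the domain pairing
`pairOfRecord`, the closeness gauge restricted, and the one-step transport `T₀` restricted along the DISPLAYED preservation clause `hT₀` (averaging maps admissible
to admissible — [I] (0.21)–(0.22) ∕ Lemma 1 content, a parameter here). [cite: Balaban1987RG1, (0.8)-(0.10) p.253, (0.21)-(0.22) p.256, (0.24)-(0.25) p.257] -/
def LevelPairing.ofRecordAdm (sp : (k j : ℕ) → (domSys (F.P k) M j).Dom → Set (CPair (F.P k) (MatA N)))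
    (gauge : GaugeField (F.P k) 0 (SU N) → GaugeField (F.P k) 0 (SU N) → ℝ) (hg : ∀ U U', 0 ≤ gauge U U')
    (T₀ : GaugeField (F.P (k + 1)) 0 (SU N) → GaugeField (F.P k) 0 (SU N))
    (hT₀ : ∀ U : GaugeField (F.P (k + 1)) 0 (SU N), (∀ (j : ℕ) (Y : (domSys (F.P (k + 1)) M j).Dom), ofBackgroundC (ιSU N) U ∈ sp (k + 1) j Y) →
      ∀ (j : ℕ) (Y : (domSys (F.P k) M j).Dom), ofBackgroundC (ιSU N) (T₀ U) ∈ sp k j Y) :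
    LevelPairing F (MatA N) M k where
  BgA := AdmBg F M N sp k
  BgB := AdmBg F M N sp (k + 1)
  gauge := fun U U' => gauge U.1 U'.1
  gauge_nonneg := fun U U' => hg U.1 U'.1
  transport := fun U => ⟨T₀ U.1, hT₀ U.1 U.2⟩
  embA := fun U => ofBackgroundC (ιSU N) U.1
  embB := fun U => ofBackgroundC (ιSU N) U.1
  pair := pairOfRecord F M k

section PairingFaces

variable (sp : (k j : ℕ) → (domSys (F.P k) M j).Dom → Set (CPair (F.P k) (MatA N)))
  (gauge : GaugeField (F.P k) 0 (SU N) → GaugeField (F.P k) 0 (SU N) → ℝ) (hg : ∀ U U', 0 ≤ gauge U U')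
  (T₀ : GaugeField (F.P (k + 1)) 0 (SU N) → GaugeField (F.P k) 0 (SU N))
  (hT₀ : ∀ U : GaugeField (F.P (k + 1)) 0 (SU N), (∀ (j : ℕ) (Y : (domSys (F.P (k + 1)) M j).Dom), ofBackgroundC (ιSU N) U ∈ sp (k + 1) j Y) →
    ∀ (j : ℕ) (Y : (domSys (F.P k) M j).Dom), ofBackgroundC (ιSU N) (T₀ U) ∈ sp k j Y)

/-- Face: run A's backgrounds are the admissible backgrounds of `F.P k`. [cite: Balaban1987RG1, (0.24) p.257 (bookkeeping)] -/
theorem LevelPairing.ofRecordAdm_BgA : (LevelPairing.ofRecordAdm F M N k sp gauge hg T₀ hT₀).BgA = AdmBg F M N sp k := rfl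
/-- Face: run B's backgrounds are the admissible backgrounds of `F.P (k+1)` — BY DEFINITION run A's slot of the NEXT pairing. [cite: Balaban1987RG1, (0.25) p.257 (bookkeeping)] -/
theorem LevelPairing.ofRecordAdm_BgB : (LevelPairing.ofRecordAdm F M N k sp gauge hg T₀ hT₀).BgB = AdmBg F M N sp (k + 1) := rfl
/-- Face: run A is read through `ιSU N` with `𝐉 = 0` on the underlying field. [cite: Balaban1987RG1, (1.9) pp.261-262 (bookkeeping)] -/
theorem LevelPairing.ofRecordAdm_embA (U : AdmBg F M N sp k) :
    (LevelPairing.ofRecordAdm F M N k sp gauge hg T₀ hT₀).embA U = ofBackgroundC (ιSU N) U.1 := rfl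
/-- Face: run B likewise. [cite: Balaban1987RG1, (1.9) pp.261-262 (bookkeeping)] -/
theorem LevelPairing.ofRecordAdm_embB (U : AdmBg F M N sp (k + 1)) :
    (LevelPairing.ofRecordAdm F M N k sp gauge hg T₀ hT₀).embB U = ofBackgroundC (ιSU N) U.1 := rfl
/-- Face: the domain pairing IS `pairOfRecord`. [cite: Balaban1987RG1, (0.24)-(0.25) p.257 (bookkeeping)] -/
theorem LevelPairing.ofRecordAdm_pair (X : W1.Dom (F.P k) M) : (LevelPairing.ofRecordAdm F M N k sp gauge hg T₀ hT₀).pair X = pairOfRecord F M k X := rfl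
/-- Face: the transport is `T₀` on the underlying fields. [cite: Balaban1987RG1, (0.8)-(0.10) p.253 (bookkeeping)] -/
theorem LevelPairing.ofRecordAdm_transport_val (U : AdmBg F M N sp (k + 1)) :
    ((LevelPairing.ofRecordAdm F M N k sp gauge hg T₀ hT₀).transport U).1 = T₀ U.1 := rfl
/-- Face: the closeness gauge is the given one on the underlying fields. [cite: Balaban1987RG1, (0.21)-(0.22) p.256 (bookkeeping)] -/
theorem LevelPairing.ofRecordAdm_gauge (U U' : AdmBg F M N sp k) :
    (LevelPairing.ofRecordAdm F M N k sp gauge hg T₀ hT₀).gauge U U' = gauge U.1 U'.1 := rfl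

/-- **THE READINGS OF RUN A LIE IN THE SPACES OF THE TABLE — BY TYPE** (the clause `hsp` of the STRIP-based producers, e.g. dag-n22-c's
`YMDAG.N22.W1.n22At_u3OfRecord₁₂_w1Reading_of_n18Below_termwise226StripOlder_eHoloAt`, at this pairing: `fun j U Y => ofRecordAdm_embA_mem … U j Y`).
[cite: Balaban1987RG1, (1.18) p.263 («for all configurations (𝐔,𝐉) ∈ U^c_j»)] -/
theorem LevelPairing.ofRecordAdm_embA_mem (U : AdmBg F M N sp k) (j : ℕ) (Y : (domSys (F.P k) M j).Dom) :
    (LevelPairing.ofRecordAdm F M N k sp gauge hg T₀ hT₀).embA U ∈ sp k j Y :=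
  U.2 j Y

/-- Run B's readings lie in the spaces of the `(k+1)`-th table likewise. [cite: Balaban1987RG1, (1.18) p.263 (bookkeeping)] -/
theorem LevelPairing.ofRecordAdm_embB_mem (U : AdmBg F M N sp (k + 1)) (j : ℕ) (Y : (domSys (F.P (k + 1)) M j).Dom) :
    (LevelPairing.ofRecordAdm F M N k sp gauge hg T₀ hT₀).embB U ∈ sp (k + 1) j Y :=
  U.2 j Y

/-- **RUN A's level functional at the admissible pairing** unfolded: `EA S g U (j, X) = Re E^{(j)}(X; g; (ιU, 0))` at the underlying field. [cite: Balaban1988RG2Cluster, (2.13) p.14 (bookkeeping)] -/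
theorem LevelPairing.EA_ofRecordAdm_apply (S : ClusterTower (F.P k) (MatA N) M) (g : ℕ → ℝ) (U : AdmBg F M N sp k) (X : W1.Dom (F.P k) M) :
    (LevelPairing.ofRecordAdm F M N k sp gauge hg T₀ hT₀).EA S g U X = (functionalC S g (ofBackgroundC (ιSU N) U.1) X).re := rfl

/-- **RUN B's first-coupling family at the admissible pairing** unfolded: `EB S′ b g U (j, X) = Re E^{(j+1)}(πX; b∷g; (ιU, 0))`. [cite: Balaban1988RG2Cluster, (2.13) p.14 (bookkeeping)] -/
theorem LevelPairing.EB_ofRecordAdm_apply (S' : ClusterTower (F.P (k + 1)) (MatA N) M) (b : ℝ) (g : ℕ → ℝ) (U : AdmBg F M N sp (k + 1)) (X : W1.Dom (F.P k) M) :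
    (LevelPairing.ofRecordAdm F M N k sp gauge hg T₀ hT₀).EB S' b g U X =
      (functionalC S' (prependCoupling b g) (ofBackgroundC (ιSU N) U.1) (pairOfRecord F M k X)).re := rfl

end PairingFaces

/-! ## §3  The reading data of record with admissible slots -/

/-- **THE W1 READING DATA OF RECORD WITH ADMISSIBLE BACKGROUND SLOTS**: towers per run length (RESIDUAL), the admissible level pairings of §2 for ONE space-table family
`sp` with the gauge and transport tables and the preservation clauses given, the K-uniform letter inputs. [cite: Balaban1988RG2Cluster, (2.13)-(2.14) pp.14-15; Balaban1987RG1, (0.24)-(0.25) p.257] -/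
def ReadingData.ofRecordAdm (S : (k : ℕ) → ClusterTower (F.P k) (MatA N) M)
    (sp : (k j : ℕ) → (domSys (F.P k) M j).Dom → Set (CPair (F.P k) (MatA N)))
    (gauge : (k : ℕ) → GaugeField (F.P k) 0 (SU N) → GaugeField (F.P k) 0 (SU N) → ℝ) (hg : ∀ k U U', 0 ≤ gauge k U U')
    (T₀ : (k : ℕ) → GaugeField (F.P (k + 1)) 0 (SU N) → GaugeField (F.P k) 0 (SU N))
    (hT₀ : ∀ (k : ℕ) (U : GaugeField (F.P (k + 1)) 0 (SU N)), (∀ (j : ℕ) (Y : (domSys (F.P (k + 1)) M j).Dom), ofBackgroundC (ιSU N) U ∈ sp (k + 1) j Y) →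
      ∀ (j : ℕ) (Y : (domSys (F.P k) M j).Dom), ofBackgroundC (ιSU N) (T₀ k U) ∈ sp k j Y)
    (li : LetterInputs) : ReadingData F (MatA N) M :=
  ⟨S, fun k => LevelPairing.ofRecordAdm F M N k sp (gauge k) (hg k) (T₀ k) (hT₀ k), li⟩

section ReadingFaces

variable (S : (k : ℕ) → ClusterTower (F.P k) (MatA N) M) (sp : (k j : ℕ) → (domSys (F.P k) M j).Dom → Set (CPair (F.P k) (MatA N)))
  (gauge : (k : ℕ) → GaugeField (F.P k) 0 (SU N) → GaugeField (F.P k) 0 (SU N) → ℝ) (hg : ∀ k U U', 0 ≤ gauge k U U')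
  (T₀ : (k : ℕ) → GaugeField (F.P (k + 1)) 0 (SU N) → GaugeField (F.P k) 0 (SU N))
  (hT₀ : ∀ (k : ℕ) (U : GaugeField (F.P (k + 1)) 0 (SU N)), (∀ (j : ℕ) (Y : (domSys (F.P (k + 1)) M j).Dom), ofBackgroundC (ιSU N) U ∈ sp (k + 1) j Y) →
    ∀ (j : ℕ) (Y : (domSys (F.P k) M j).Dom), ofBackgroundC (ιSU N) (T₀ k U) ∈ sp k j Y)
  (li : LetterInputs) (γ : ℝ)

/-- Face: the towers are the given ones. [cite: Balaban1988RG2Cluster, (2.13) p.14 (bookkeeping)] -/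
theorem ReadingData.ofRecordAdm_S : (ReadingData.ofRecordAdm F M N S sp gauge hg T₀ hT₀ li).S = S := rfl
/-- Face: the level pairings are the admissible pairings of record. [cite: Balaban1987RG1, (0.24)-(0.25) p.257 (bookkeeping)] -/
theorem ReadingData.ofRecordAdm_pairing :
    (ReadingData.ofRecordAdm F M N S sp gauge hg T₀ hT₀ li).pairing k = LevelPairing.ofRecordAdm F M N k sp (gauge k) (hg k) (T₀ k) (hT₀ k) := rfl
/-- Face: the letter inputs are the given ones. [cite: Balaban1987RG1, Thm 1 p.259 (bookkeeping)] -/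
theorem ReadingData.ofRecordAdm_li : (ReadingData.ofRecordAdm F M N S sp gauge hg T₀ hT₀ li).li = li := rfl

/-- **RUN A AT THE ADMISSIBLE READING**: `EA k g U (j, X) = Re E^{(j)}(X; g; (ιU, 0))` for an ADMISSIBLE `U`. [cite: Balaban1987RG1, (1.18) p.263; Balaban1988RG2Cluster, (2.13) p.14 (bookkeeping)] -/
theorem ReadingData.u3Objects_ofRecordAdm_EA_apply (g : ℕ → ℝ) (U : AdmBg F M N sp k) (X : W1.Dom (F.P k) M) :
    ((ReadingData.ofRecordAdm F M N S sp gauge hg T₀ hT₀ li).u3Objects γ).EA k g U X = (functionalC (S k) g (ofBackgroundC (ιSU N) U.1) X).re := rfl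

/-- **RUN B AT THE ADMISSIBLE READING**: `EB k b g U (j, X) = Re E^{(j+1)}(πX; b∷g; (ιU, 0))` for an admissible `U` on `F.P (k+1)`. [cite: Balaban1987RG1, (0.24)-(0.25) p.257 (bookkeeping)] -/
theorem ReadingData.u3Objects_ofRecordAdm_EB_apply (b : ℝ) (g : ℕ → ℝ) (U : AdmBg F M N sp (k + 1)) (X : W1.Dom (F.P k) M) :
    ((ReadingData.ofRecordAdm F M N S sp gauge hg T₀ hT₀ li).u3Objects γ).EB k b g U X =
      (functionalC (S (k + 1)) (prependCoupling b g) (ofBackgroundC (ιSU N) U.1) (pairOfRecord F M k X)).re := rfl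

/-- **NE5 AT THE ADMISSIBLE READING** (`Iff.rfl`): node N18's literal, quantified over ADMISSIBLE run-B backgrounds `U` of `F.P (k+1)`, run A read at `T₀ U`.
[cite: Balaban1987RG1, Thm 1 p.259 and (1.18) p.263 (NE5 is NOT printed; bookkeeping)] -/
theorem ReadingData.ne5_ofRecordAdm_iff (b : ℝ) (W : Set (ℕ → ℝ)) (κ θ C₅ : ℝ) :
    NE5 (((ReadingData.ofRecordAdm F M N S sp gauge hg T₀ hT₀ li).u3Objects γ).EA k)
        (((ReadingData.ofRecordAdm F M N S sp gauge hg T₀ hT₀ li).u3Objects γ).EB k b) W κ θ C₅ ↔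
      ∀ g ∈ W, ∀ (U : AdmBg F M N sp (k + 1)) (X : W1.Dom (F.P k) M),
        |(functionalC (S k) g (ofBackgroundC (ιSU N) (T₀ k U.1)) X).re -
            (functionalC (S (k + 1)) (prependCoupling b g) (ofBackgroundC (ιSU N) U.1) (pairOfRecord F M k X)).re| ≤
          C₅ * θ ^ X.1 * Real.exp (-(κ * (domSys (F.P k) M X.1).dj X.2)) :=
  Iff.rfl

/-- **NE9 AT THE ADMISSIBLE READING** (`Iff.rfl`): the history-Lipschitz inequality for `Re E^{(j)}(X; ·; (ιU, 0))`, quantified over ADMISSIBLE run-A backgrounds `U`.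
[cite: Balaban1987RG1, (1.18) p.263 and p.298 (NE9 is NOT printed; bookkeeping)] -/
theorem ReadingData.ne9_ofRecordAdm_iff (W : Set (ℕ → ℝ)) (κ : ℝ) (Λ : ℕ → ℕ → ℝ) :
    NE9 (C := ((ReadingData.ofRecordAdm F M N S sp gauge hg T₀ hT₀ li).u3Objects γ).levelCarriers k)
        (((ReadingData.ofRecordAdm F M N S sp gauge hg T₀ hT₀ li).u3Objects γ).EA k) W κ Λ ↔
      ∀ g ∈ W, ∀ g' ∈ W, ∀ (U : AdmBg F M N sp k) (X : W1.Dom (F.P k) M),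
        |(functionalC (S k) g (ofBackgroundC (ιSU N) U.1) X).re - (functionalC (S k) g' (ofBackgroundC (ιSU N) U.1) X).re| ≤
          Real.exp (-(κ * (domSys (F.P k) M X.1).dj X.2)) * ∑ i ∈ Finset.range X.1, Λ X.1 i * |g i - g' i| :=
  Iff.rfl

end ReadingFaces

/-! ## §4  The generated tables (v1.1): the averaging-closure of the strictly small fields — `hT₀` by construction, the print's clause in origin form -/

section GeneratedGeneric

variable {Bk : ℕ → Type*} (Pplus : (k : ℕ) → Bk k → Prop) (T : (k : ℕ) → Bk (k + 1) → Bk k)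

/-- **THE GENERATED FAMILY** over level-indexed background types `Bk k`, strict admissibility `Pplus k` and one-step transports `T k : Bk (k+1) → Bk k`:
the LEAST family containing the strictly small fields and closed under the transports (King's nesting of small-field restrictions by construction; [I]'s
condition (iv) «all the averages M^n(U)» read as a closure). [cite: Balaban1987RG1, p.262 (iv) and (1.15)-(1.16); King1986, (3.40)-(3.42) p.660] -/
inductive AvGen : (k : ℕ) → Bk k → Prop
  | strict {k : ℕ} {U : Bk k} (h : Pplus k U) : AvGen k U
  | transport {k : ℕ} {U : Bk (k + 1)} (h : AvGen (k + 1) U) : AvGen k (T k U)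

/-- **THE `a`-FOLD AVERAGE** from level `k + a` down to level `k`, TOP STEP FIRST (every index identity definitional: `M^a(U)` of [I] p.263 L9).
[cite: Balaban1987RG1, p.263 L9-13 (M^n(U) = U^n)] -/
def avIter (k : ℕ) : (a : ℕ) → Bk (k + a) → Bk k
  | 0, U => U
  | a + 1, U => avIter k a (T (k + a) U)

/-- Face: no averaging. [cite: Balaban1987RG1, p.263 L9 (bookkeeping)] -/
@[simp] theorem avIter_zero (k : ℕ) (U : Bk (k + 0)) : avIter T k 0 U = U := rfl

/-- Face: one more averaging = the top step first. [cite: Balaban1987RG1, p.263 L9 (bookkeeping)] -/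
@[simp] theorem avIter_succ (k a : ℕ) (U : Bk (k + (a + 1))) : avIter T k (a + 1) U = avIter T k a (T (k + a) U) := rfl

/-- Averages of generated backgrounds are generated. [cite: Balaban1987RG1, p.262 (iv) (bookkeeping)] -/
theorem avGen_avIter (k : ℕ) : ∀ (a : ℕ) (V : Bk (k + a)), AvGen Pplus T (k + a) V → AvGen Pplus T k (avIter T k a V)
  | 0, _, h => h
  | a + 1, _, h => avGen_avIter k a _ (AvGen.transport h)

/-- **ORIGIN ⇒ GENERATED**: the `a`-fold average of a strictly small field `a` levels up is generated. [cite: Balaban1987RG1, p.263 L9-13 (bookkeeping)] -/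
theorem avGen_of_origin {k a : ℕ} {U₀ : Bk (k + a)} (h : Pplus (k + a) U₀) : AvGen Pplus T k (avIter T k a U₀) :=
  avGen_avIter Pplus T k a U₀ (AvGen.strict h)

/-- The displayed clause in GENERATED form `hunif` is consumed pointwise. [cite: Balaban1987RG1, p.263 L5-21 (the clause; bookkeeping)] -/
theorem AvGen.mem {Pk : (k : ℕ) → Bk k → Prop} (hunif : ∀ (k : ℕ) (U : Bk k), AvGen Pplus T k U → Pk k U) {k : ℕ} {U : Bk k}
    (h : AvGen Pplus T k U) : Pk k U :=
  hunif k U h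

/-- Level transport of a background along an index identity (the one cast of this section). [cite: Balaban1987RG1, p.263 L9 (bookkeeping)] -/
def castLevel {m n : ℕ} (h : m = n) (U : Bk m) : Bk n := h ▸ U

/-- Face: transport along `rfl` is the identity. [cite: Balaban1987RG1, p.263 L9 (bookkeeping)] -/
@[simp] theorem castLevel_rfl {m : ℕ} (U : Bk m) : castLevel (Bk := Bk) rfl U = U := rfl

/-- The one-step transports commute with level transport. [cite: Balaban1987RG1, p.263 L9 (bookkeeping)] -/
theorem T_castLevel {m n : ℕ} (h : m = n) (U : Bk (m + 1)) :
    T n (castLevel (congrArg (· + 1) h) U) = castLevel h (T m U) := by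
  subst h
  rfl

/-- Strict admissibility is invariant under level transport. [cite: Balaban1987RG1, p.262 (i)-(iii) (bookkeeping)] -/
theorem Pplus_castLevel_iff {m n : ℕ} (h : m = n) (U : Bk m) : Pplus n (castLevel h U) ↔ Pplus m U := by
  subst h
  exact Iff.rfl

/-- **BOTTOM STEP LAST = TOP STEP FIRST**, up to the one index identity `k + 1 + a = k + a + 1`. [cite: Balaban1987RG1, p.263 L9-13 (M^{n+1} = M ∘ M^n; bookkeeping)] -/
theorem T_avIter_succ (k : ℕ) : ∀ (a : ℕ) (U₀ : Bk (k + 1 + a)),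
    T k (avIter T (k + 1) a U₀) = avIter T k (a + 1) (castLevel (Nat.add_right_comm k 1 a) U₀)
  | 0, U₀ => rfl
  | a + 1, U₀ => by
    rw [avIter_succ, T_avIter_succ k a, avIter_succ, avIter_succ, avIter_succ]
    congr 1
    rw [← T_castLevel T (Nat.add_right_comm k 1 a) U₀]
    rfl

/-- ★ **ORIGIN CHARACTERISATION**: a background is generated iff it is an `a`-fold average of a strictly small field `a` levels up — so the displayed
clause may be stated in the print's form (regularity of `M^n(U)` for regular `U`, UNIFORMLY in `n`). [cite: Balaban1987RG1, p.263 L9-13 and p.262 (iv)] -/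
theorem avGen_iff_origin {k : ℕ} {U : Bk k} :
    AvGen Pplus T k U ↔ ∃ (a : ℕ) (U₀ : Bk (k + a)), Pplus (k + a) U₀ ∧ avIter T k a U₀ = U := by
  constructor
  · intro h
    induction h with
    | strict h => exact ⟨0, _, h, rfl⟩
    | transport h ih =>
      obtain ⟨a, U₀, h₀, rfl⟩ := ih
      exact ⟨a + 1, castLevel (Nat.add_right_comm _ 1 a) U₀, (Pplus_castLevel_iff Pplus _ U₀).2 h₀, (T_avIter_succ T _ a U₀).symm⟩
  · rintro ⟨a, U₀, h₀, rfl⟩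
    exact avGen_of_origin Pplus T h₀

/-- **THE DISPLAYED CLAUSE IN ORIGIN FORM DISCHARGES THE GENERATED FORM**: `horig` (averages of strictly small fields lie in the table, uniformly in the number of
averagings — [I] p.263 L9-13 with `2B₃·α₀′ ≤ α₀`, Prop. 9 of [15]; DISPLAYED, not proved) ⇒ every generated background lies in the table.
[cite: Balaban1987RG1, p.263 L5-21] -/
theorem AvGen.mem_of_origin {Pk : (k : ℕ) → Bk k → Prop}
    (horig : ∀ (k a : ℕ) (U₀ : Bk (k + a)), Pplus (k + a) U₀ → Pk k (avIter T k a U₀)) {k : ℕ} {U : Bk k}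
    (h : AvGen Pplus T k U) : Pk k U := by
  obtain ⟨a, U₀, h₀, rfl⟩ := (avGen_iff_origin Pplus T).1 h
  exact horig k a U₀ h₀

end GeneratedGeneric

section GeneratedW1

/-- ★ **THE READING `U ↦ (ιU, 0)` OF `SU(N)`-VALUED BACKGROUNDS IN `Φ` IS INJECTIVE** (the embedded unit IS the matrix, `coe_ιSU`).
[cite: Balaban1987RG1, pp.251-252 and (1.10) p.262 (bookkeeping)] -/
theorem ofBackgroundC_ιSU_injective {P : Params} :
    Function.Injective (ofBackgroundC (P := P) (ιSU N) : GaugeField P 0 (SU N) → CPair P (MatA N)) := by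
  intro U U' h
  funext b
  have hb := congrFun (congrArg Prod.fst h) b
  exact Subtype.ext (by simpa [ofBackgroundC, coe_ιSU] using hb)

variable (Pplus : (k : ℕ) → GaugeField (F.P k) 0 (SU N) → Prop)
  (T₀ : (k : ℕ) → GaugeField (F.P (k + 1)) 0 (SU N) → GaugeField (F.P k) 0 (SU N))

/-- **THE GENERATED TABLE FAMILY** `spGen`: at slot `k`, for every creation step `j` and domain `Y`, the image in `Φ(F.P k)` of the averaging-closure
`AvGen Pplus T₀ k` of the strictly small fields (constant in `(j, Y)`: [I]'s (iv) puts the averages into EVERY `U^c_j(Y, ·)`).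
[cite: Balaban1987RG1, p.262 (iv) and (1.15)-(1.16); King1986, (3.42) p.660] -/
def spGen : (k j : ℕ) → (domSys (F.P k) M j).Dom → Set (CPair (F.P k) (MatA N)) :=
  fun k _ _ => {φ | ∃ U : GaugeField (F.P k) 0 (SU N), AvGen Pplus T₀ k U ∧ φ = ofBackgroundC (ιSU N) U}

variable {F M N Pplus T₀} in
/-- Membership of a reading in the generated table = the background is generated. [cite: Balaban1987RG1, p.262 (iv) (bookkeeping)] -/
theorem mem_spGen_iff {k j : ℕ} (Y : (domSys (F.P k) M j).Dom) (U : GaugeField (F.P k) 0 (SU N)) :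
    ofBackgroundC (ιSU N) U ∈ spGen F M N Pplus T₀ k j Y ↔ AvGen Pplus T₀ k U := by
  constructor
  · rintro ⟨U', hU', h⟩
    rwa [ofBackgroundC_ιSU_injective N h]
  · exact fun h => ⟨U, h, rfl⟩

/-- ONE INHABITED DOMAIN INDEX at every level: the single `M`-cube at the origin of `T^{(0)}` (`𝐃_0 ≠ ∅`). [cite: Balaban1987RG1, p.257 (the cubes π_j ⊂ 𝐃_j)] -/
def domZero (P : Params) (M : ℕ) : (domSys P M 0).Dom :=
  cubeDom P M 0 fun _ => 0

/-- ★ **`hT₀` ON THE GENERATED TABLES IS A THEOREM**: the one-step transport of a background admissible at slot `k + 1` is admissible at slot `k` — transport is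
the constructor `AvGen.transport` (King's nesting by construction). [cite: Balaban1987RG1, (0.21)-(0.22) p.256 and p.262 (iv); King1986, (3.42) p.660] -/
theorem hT₀_spGen (k : ℕ) (U : GaugeField (F.P (k + 1)) 0 (SU N))
    (hU : ∀ (j : ℕ) (Y : (domSys (F.P (k + 1)) M j).Dom), ofBackgroundC (ιSU N) U ∈ spGen F M N Pplus T₀ (k + 1) j Y)
    (j : ℕ) (Y : (domSys (F.P k) M j).Dom) : ofBackgroundC (ιSU N) (T₀ k U) ∈ spGen F M N Pplus T₀ k j Y :=
  (mem_spGen_iff Y _).2 (AvGen.transport ((mem_spGen_iff (domZero (F.P (k + 1)) M) U).1 (hU 0 _)))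

variable {F M N Pplus T₀} in
/-- A slot-`k` admissible background at the generated tables IS a generated background. [cite: Balaban1987RG1, p.262 (iv) (bookkeeping)] -/
theorem AdmBg.avGen {k : ℕ} (U : AdmBg F M N (spGen F M N Pplus T₀) k) : AvGen Pplus T₀ k U.1 :=
  (mem_spGen_iff (domZero (F.P k) M) U.1).1 (U.2 0 _)

variable {F N Pplus T₀} in
/-- A generated background is a slot-`k` admissible background at the generated tables (the slot carriers at `spGen` ARE the generated carrier).
[cite: Balaban1987RG1, p.262 (iv) (bookkeeping)] -/
def AdmBg.ofAvGen {k : ℕ} (U : GaugeField (F.P k) 0 (SU N)) (h : AvGen Pplus T₀ k U) : AdmBg F M N (spGen F M N Pplus T₀) k :=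
  ⟨U, fun _ Y => (mem_spGen_iff Y U).2 h⟩

variable {F N Pplus T₀} in
/-- Face: the underlying field. [cite: Balaban1987RG1, p.262 (iv) (bookkeeping)] -/
@[simp] theorem AdmBg.ofAvGen_val {k : ℕ} (U : GaugeField (F.P k) 0 (SU N)) (h : AvGen Pplus T₀ k U) : (AdmBg.ofAvGen M U h).1 = U := rfl

variable {F N Pplus T₀} in
/-- **NON-EMPTINESS HOOK**: a strictly small field at level `k` (e.g. a minimiser, [I] p.263 L19-21 «the minimal configurations U_j … satisfy the above conditions»)
inhabits the slot-`k` carrier at the generated tables. [cite: Balaban1987RG1, p.263 L19-21] -/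
theorem AdmBg.nonempty_spGen_of_strict {k : ℕ} (U : GaugeField (F.P k) 0 (SU N)) (h : Pplus k U) :
    Nonempty (AdmBg F M N (spGen F M N Pplus T₀) k) :=
  ⟨AdmBg.ofAvGen M U (AvGen.strict h)⟩

variable {F M N Pplus T₀} in
/-- **THE DISPLAYED CLAUSE (generated form) ⇒ THE ENTRYWISE INCLUSION `spGen ⊆ sp`** — what the antitone transfer of rate statements between table families consumes;
`hunif` = [I] p.263 L5-21 («natural spaces contained in U^c_j … with constants α₀′, α₁′»), DISPLAYED, not proved. [cite: Balaban1987RG1, p.263 L5-21] -/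
theorem spGen_subset_of_hunif {sp : (k j : ℕ) → (domSys (F.P k) M j).Dom → Set (CPair (F.P k) (MatA N))}
    (hunif : ∀ (k : ℕ) (U : GaugeField (F.P k) 0 (SU N)), AvGen Pplus T₀ k U →
      ∀ (j : ℕ) (Y : (domSys (F.P k) M j).Dom), ofBackgroundC (ιSU N) U ∈ sp k j Y)
    (k j : ℕ) (Y : (domSys (F.P k) M j).Dom) : spGen F M N Pplus T₀ k j Y ⊆ sp k j Y := by
  rintro φ ⟨U, hU, rfl⟩
  exact hunif k U hU j Y

variable {F M N Pplus T₀} in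
/-- **THE DISPLAYED CLAUSE IN THE PRINT's ORIGIN FORM ⇒ THE INCLUSION**: `horig` — the `a`-fold averages of strictly small fields `a` levels up read inside the table,
UNIFORMLY in `a` ([I] p.263 L9-13, one factor `2B₃` for all `a`, Prop. 9 of [15]; DISPLAYED, not proved). [cite: Balaban1987RG1, p.263 L9-13] -/
theorem spGen_subset_of_origin {sp : (k j : ℕ) → (domSys (F.P k) M j).Dom → Set (CPair (F.P k) (MatA N))}
    (horig : ∀ (k a : ℕ) (U₀ : GaugeField (F.P (k + a)) 0 (SU N)), Pplus (k + a) U₀ →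
      ∀ (j : ℕ) (Y : (domSys (F.P k) M j).Dom), ofBackgroundC (ιSU N) (avIter (Bk := fun k => GaugeField (F.P k) 0 (SU N)) T₀ k a U₀) ∈ sp k j Y)
    (k j : ℕ) (Y : (domSys (F.P k) M j).Dom) : spGen F M N Pplus T₀ k j Y ⊆ sp k j Y :=
  spGen_subset_of_hunif (fun _ _ hU => AvGen.mem_of_origin Pplus T₀
    (Pk := fun k U => ∀ (j : ℕ) (Y : (domSys (F.P k) M j).Dom), ofBackgroundC (ιSU N) U ∈ sp k j Y) horig hU) k j Y

variable (S : (k : ℕ) → ClusterTower (F.P k) (MatA N) M)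
  (gauge : (k : ℕ) → GaugeField (F.P k) 0 (SU N) → GaugeField (F.P k) 0 (SU N) → ℝ) (hg : ∀ k U U', 0 ≤ gauge k U U')
  (li : LetterInputs)

/-- ★ **THE W1 READING AT THE GENERATED TABLES** — the instance of `ReadingData.ofRecordAdm` at `sp := spGen F M N Pplus T₀` on which the preservation clause is the
THEOREM `hT₀_spGen` (no displayed `hT₀`); the Bałaban content left is the inclusion clause `hunif` ∕ `horig` (`spGen_subset_of_hunif` ∕ `_of_origin`).
[cite: Balaban1987RG1, (0.24)-(0.25) p.257, p.262 (iv), p.263 L5-21; Balaban1988RG2Cluster, (2.13) p.14] -/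
def ReadingData.ofRecordGen : ReadingData F (MatA N) M :=
  ReadingData.ofRecordAdm F M N S (spGen F M N Pplus T₀) gauge hg T₀ (hT₀_spGen F M N Pplus T₀) li

/-- Face: the towers are the given ones. [cite: Balaban1988RG2Cluster, (2.13) p.14 (bookkeeping)] -/
@[simp] theorem ReadingData.ofRecordGen_S : (ReadingData.ofRecordGen F M N Pplus T₀ S gauge hg li).S = S := rfl

/-- Face: the letter inputs are the given ones. [cite: Balaban1987RG1, Thm 1 p.259 (bookkeeping)] -/
@[simp] theorem ReadingData.ofRecordGen_li : (ReadingData.ofRecordGen F M N Pplus T₀ S gauge hg li).li = li := rfl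

/-- Face: the level pairings are the admissible pairings of record at the generated tables. [cite: Balaban1987RG1, (0.24)-(0.25) p.257 (bookkeeping)] -/
theorem ReadingData.ofRecordGen_pairing :
    (ReadingData.ofRecordGen F M N Pplus T₀ S gauge hg li).pairing k =
      LevelPairing.ofRecordAdm F M N k (spGen F M N Pplus T₀) (gauge k) (hg k) (T₀ k) (hT₀_spGen F M N Pplus T₀ k) := rfl

/-- Face (`rfl`): the generated reading IS the admissible reading at `spGen` with `hT₀ := hT₀_spGen` — every `…ofRecordAdm…` face and `Iff.rfl` literal of §2–§3
applies verbatim after this rewrite. [cite: Balaban1987RG1, (0.24)-(0.25) p.257 (bookkeeping)] -/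
theorem ReadingData.ofRecordGen_eq : ReadingData.ofRecordGen F M N Pplus T₀ S gauge hg li =
    ReadingData.ofRecordAdm F M N S (spGen F M N Pplus T₀) gauge hg T₀ (hT₀_spGen F M N Pplus T₀) li := rfl

end GeneratedW1


end W1

end Literature.MathematicalPhysics.QuantumFieldTheory.Balaban1983to89.Node00

end
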